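import Literature.Topology.FourManifolds.GompfFramedTwistHolds
import Literature.Topology.FourManifolds.GompfFramedTwistZero
import HarnessLib

/-!
# Discharges of named facts of `GompfFramedSpheres.lean`

`Literature/Topology/FourManifolds/GompfFramedSpheresHolds.lean` — proofs-only sibling of
`GompfFramedSpheres.lean` (no definitions, no named facts). Each theorem below closes a named
fact `X : Prop` of that file as `X_holds : X` by composing an ACCEPTED reduction theorem of
the tree with the ACCEPTED unconditional `_holds` discharges of all of its hypotheses; nothing
is re-proved and no statement is changed. Recorded by the librarian sweep g25 (2026-08-16,
pass 5c: facts dischargeable in one line from the tree's own lemmas), so that the facts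
census, `#h21_route_deps` and the cone guardrail see these facts as theorems.

Discharged here:

* `gompf2010_thm43_holds` := `gompf2010_thm43_of_framedTwist` `gompf2010_framedTwist_holds`
  (`GompfFramedTwistZero.lean`).

## References

* [GompfAGT2010] — see `lean/references.bib` and the docstring of the fact in `GompfFramedSpheres.lean`.
-/

namespace Literature.Topology.FourManifolds

/-- **Discharge of the named fact `gompf2010_thm43`** (`GompfFramedSpheres.lean`): Gompf 2010,
Theorem 4.3 (framed form): "The two Cappell–Shaneson spheres given by the matrix `A₀` of
Example 3.1(a) are diffeomorphic." With `X^σ_{A₀} = gompfSphere A₀ γ`, `σ = [γ]`: … — obtained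
as `gompf2010_thm43_of_framedTwist` applied to the tree's unconditional discharge
`gompf2010_framedTwist_holds` of its hypothesis (reduction in `GompfFramedTwistZero.lean`).
[cite: GompfAGT2010, Thm 4.3] -/
theorem gompf2010_thm43_holds :
    gompf2010_thm43 :=
  gompf2010_thm43_of_framedTwist gompf2010_framedTwist_holds

end Literature.Topology.FourManifolds
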